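import Summits.QuantumFields.YangMills.Theses.SmallFieldWidening
import Summits.QuantumFields.YangMills.Theorems.SmallFieldWideningWideningOfTiltAndMassSmallFieldCauchy

/-!
# Route `SmallFieldWidening` (QuantumFields / YangMills; closes the rung-R3 leaf `T3YM3TorusStatement.YM3TorusSU2`) — THE ASSEMBLY ITEM
# (stmt-QuantumFields-22886), PROVED: `AllHeightsSmallTilt → LargeFieldMassRefinementTail → WideningOfTiltAndMass → YM3TorusSU2`

Width seat `ym-line-sfw-p2-w3` (2026-08-27), pattern of `UnitScaleTiltAssembly`.  The route's deciding theorem `SmallFieldWidening.closes`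
(planner ym-idea-1 g0, gate-rendered and kernel-checked in the Theses file: the leaf's `γ₁ := 1`; for `F`, `0 < γ`: the profile, threshold and
K-uniform mass `δ` from r3 at `L = F.L`, `γ₂` from r2, a refinement depth `n₀` with `γL^{-n} ≤ min γ₁' γ₂` for `n ≥ n₀`, r2 at every `F.refine n`,
the widening support, and `continuumYM3Torus_iff_hasContinuumLimit_SU`) IS the assembly item's statement; this file records it BY NAME.

WHAT THIS IS NOT: not a proof of r2 `AllHeightsSmallTilt` (open-problem, booked as UnitScaleTilt's K1′ at `m = 0`) nor of r3
`LargeFieldMassRefinementTail` (⇐ the K2-L socket `IntCoreRec`, OPEN); s9 `WideningOfTiltAndMass` is closed.  Not d = 4, not a mass gap, not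
Clay: the route bears on the RECORD rung R3 (`YM3TorusSU2`), and no summit is proved by it.
-/

noncomputable section

namespace Summit.QuantumFields.YangMills.Theorems

open Literature.MathematicalPhysics.QuantumFieldTheory.Balaban1983to89
open Literature.MathematicalPhysics.QuantumFieldTheory.Balaban1983to89.Missing
open Literature.MathematicalPhysics.QuantumFieldTheory.Balaban1983to89.T3ContinuumYM3Torus
open Literature.MathematicalPhysics.QuantumFieldTheory.Balaban1983to89.T3UnitLawDensityEML (ℰp measurableE_ℰp)
open Literature.MathematicalPhysics.QuantumFieldTheory.Balaban1983to89.T3UnitScaleTilt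

/-- **THE ASSEMBLY ITEM OF ROUTE `SmallFieldWidening`, PROVED**: `AllHeightsSmallTilt → LargeFieldMassRefinementTail → WideningOfTiltAndMass →
YM3TorusSU2` — the gate's kernel-checked deciding theorem `SmallFieldWidening.closes` by name. -/
theorem smallFieldWidening_assembly_proof : Summit.QuantumFields.YangMills.Theses.SmallFieldWidening.Assembly :=
  -- Route rev 5 (2026-08-28T12:26Z, LINE g6-C «Cauchy door») re-keyed `closes` to `WindowCondCauchy` / `CauchyAssembly`; this item's
  -- statement is unchanged, so the glue now runs through the landed Cauchy door: King's all-heights tilt `hT` gives the window-conditional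
  -- Cauchy hypothesis (windows `E_K := histGood_K`, `K₀ := 0`, composition `smallFieldCauchy_of_unitTiltAt_zero`), and
  -- `WideningSmallFieldCauchy.ym3TorusSU2_of_windowCondCauchy` widens it with the mass tail `hM`; the tilt widening (3rd binder) is not needed.
  fun hT hM _ => by
    refine Summit.QuantumFields.YangMills.Theorems.WideningSmallFieldCauchy.ym3TorusSU2_of_windowCondCauchy (fun L => ?_) hM
    refine ⟨1, 3, fun b₀ p₀ _ _ hb₀ hp₀ => ?_⟩
    obtain ⟨γ₁, hγ₁, h⟩ := hT L b₀ p₀ hb₀ hp₀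
    refine ⟨γ₁, hγ₁, fun F γ hFL hγ hγγ₁ => ⟨0, fun K => histGood F ℰp (θBal F.L γ b₀ p₀) K 0,
      fun K => measurableSet_histGood F ℰp measurableE_ℰp _ K 0, fun K _ => subset_rfl, fun W hWm hW => ?_⟩⟩
    simpa only [Nat.add_zero] using
      Summit.QuantumFields.YangMills.Theorems.WideningSmallFieldCauchy.smallFieldCauchy_of_unitTiltAt_zero F hγ.le
        (h F γ hFL hγ hγγ₁) hWm hW

end Summit.QuantumFields.YangMills.Theorems

end
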